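import Summits.ResolutionOfSingularities.ResolutionOfSingularities.Theorems.ConeCutZigzag
import HarnessLib

/-!
# ConeCutLaws — tree file 9/11: §B⁺⁺⁺ ALL-REPEAT RIGIDITY (LAW C for every eventually-all-repeat word,
`IsRigidRepeatTailFrom`),
§C⁵ LAW I (`lawI`: after a repeat followed by an untranslated chart change, kept third exponent + new exponent
≤ q − 2 — over the
tree's AXIS LAW `Theorems/ConeCutAxisLaw`), §D BOOKING state-level predicates (`IsConeLine`, `IsRigidHighFloorFrom`).  PROVED.

Content VERBATIM from the decomp-res lens-3 g15 file `HOME/decomp-res-lens-3/g15/parts/ConeCut-rev5-f76e5309.lean`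
(sha256 f76e53096babc227…; CRITIC-LEDGER
rows 102/105/110/123 CLEARED, landing orders 15:53:15Z / 17:40:15Z).  HOME = run/shared/lean/pub/decomp-res.  Host:
route `MaxContactCut`, aside
31770 `DefectWalksDeep` (and 31870) through the tree's lens-3 g14 `Theorems/FloorCut{Classes,Floor}` + `MaxContactCutFloorCut`.

[WRITER NOTE (decomp-res writer g6): per the lens's own landing instruction its §0 (l.130–876 = g14 `FloorCut`
VERBATIM) is DELETED and the
tree's `…Theorems.FloorCut` opened instead; §C⁵ `section AxisLaw` (l.2949–3086) is the tree's
`Theorems/ConeCutAxisLaw` (landed earlier,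
opened here); the restated ProximityCut letters `LeavesNewest` / `StaysOnNewest` / `leavesNewest_iff_not_stays` /
`NoFreePointTailsDeep`
(byte-identical to `Theorems/ProximityCutClasses`) are deleted and opened from the tree; the three class definitions
`IsTameFrom`,
`NoMixedTailsDeep`, `NoTameMixedTailsDeep` live in the cone-free `Theorems/ConeCutClasses` (so the route can import
the co-owned MIXED
aside).  Split: ConeCutClasses · ConeCutLayers / ConeCutLayersPoint (§A state level) · ConeCutWalks (§B) ·
ConeCutLawB (§C) · ConeCutRepeats
(§B⁺, §B⁺⁺⁺ part 1) · ConeCutLawE (§B⁺⁺⁺ part 2, LAW E) · ConeCutZigzag (§B⁺⁺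
Fibonacci/zigzag, LAW C) · ConeCutLaws (all-repeat rigidity,
LAW I, §D booking) · MaxContactCutConeCut / MaxContactCutConeCutCells (§D wiring to 31770/31870 BY NAME, Theses
cone).  ONE namespace
`…Theorems.ConeCut` as in the lens; global `set_option` lines dropped; nothing else changed.]
(Sources: Hauser2010 §§D,F,G; HauserPerlega2019; Moh1987; CossartPiltant2019; CossartJannsenSaito2020 Thm. 2.14,
§§5,9; BenitoVillamayor2013 §7; CasasAlvero2000 Ch. 3; BierstoneGrigorievMilmanWlodarczyk2011 Def. 3.1.3.)
-/

noncomputable section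

open MvPolynomial Finset
open Literature.AlgebraicGeometry.Resolution
open Literature.AlgebraicGeometry.Resolution.Hauser2010
open Literature.AlgebraicGeometry.Resolution.PointBlowup
open Summit.ResolutionOfSingularities.ResolutionOfSingularities.Theorems.TightDefectClasses
open Summit.ResolutionOfSingularities.ResolutionOfSingularities.Theorems.TightDefectStrongWalks
open Summit.ResolutionOfSingularities.ResolutionOfSingularities.Theorems.ItineraryCutClasses
open Summit.ResolutionOfSingularities.ResolutionOfSingularities.Theorems.BoundaryLedger
open Literature.AlgebraicGeometry.Resolution.WeightedBlowup
open Literature.Barriers.ResolutionOfSingularities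
open Summit.ResolutionOfSingularities.ResolutionOfSingularities.Theorems.FloorCut
open Summit.ResolutionOfSingularities.ResolutionOfSingularities.Theorems.ConeCutAxisLaw
open Summit.ResolutionOfSingularities.ResolutionOfSingularities.Theorems.ProximityCut (NoOriginTails LeavesNewest StaysOnNewest)
open Summit.ResolutionOfSingularities.ResolutionOfSingularities.Theorems.ProximityCut (leavesNewest_iff_not_stays NoFreePointTailsDeep)
open Summit.ResolutionOfSingularities.ResolutionOfSingularities.Theorems.ExitLaw (fin3_cases)

namespace Summit.ResolutionOfSingularities.ResolutionOfSingularities.Theorems.ConeCut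

/-! ## §B⁺⁺⁺ ALL-REPEAT RIGIDITY (g15 rev 3): LAW C for every eventually-all-repeat word

The zigzag hypothesis of LAW C is not needed: by the double-repeat law a chart-SWITCHING repeat is translated off the
old component, so along ANY all-repeat word the "third-component excess" of the kept vector can only be inherited
(zigzag move at the origin of the third axis) or killed (translation or switch) — it is eventually zero as soon as one
translation happens, after which the ledger is the same bounded Fibonacci recurrence. -/

section AllRepeat

variable {K : Type} [Field K] [DecidableEq K] {q : ℕ} {s₀ : State (Fin 3) K}

/-- ENTRY: at a translated repeat `t + 1` the kept vector is exactly the old newest component. [new] [folklore] -/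
theorem allRepeat_kept_entry (W : ForcedWalk q s₀) (t : ℕ) (hS : StaysOnNewest W t) (hb : W.b (t + 1) ≠ 0)
    {o : ℕ} (ho : ordZero (W.st t).F = o) : kept W (t + 1) = Finsupp.single (W.j t) (o - q) := by
  classical
  obtain ⟨l₀, h0a, h0c⟩ : ∃ l₀ : Fin 3, l₀ ≠ W.j t ∧ l₀ ≠ W.j (t + 1) := by
    have aux : ∀ a c : Fin 3, ∃ k : Fin 3, k ≠ a ∧ k ≠ c := by decide
    exact aux _ _
  have hb0 : W.b (t + 1) l₀ ≠ 0 := by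
    intro h; apply hb; funext l
    rcases fin3_cases hS.1.symm h0a h0c l with hl | hl | hl
    · rw [hl]; exact hS.2
    · rw [hl]; exact W.onExc (t + 1)
    · rw [hl]; exact h
  ext l
  rw [kept_apply, Finsupp.single_apply]
  rcases fin3_cases hS.1.symm h0a h0c l with hl | hl | hl
  · rw [hl, if_pos ⟨hS.1.symm, hS.2⟩, if_pos rfl, NoJump.r_succ_chart W t ho]
  · rw [hl, if_neg (fun h => h.1 rfl), if_neg (fun h => hS.1 h.symm)]
  · rw [hl, if_neg (fun h => hb0 h.2), if_neg (fun h => h0a h.symm)]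

/-- PERSISTENCE: along an all-repeat word on a high plateau (shade `s ≥ 1`), if move `u + 1` keeps exactly the old
newest component then so does move `u + 2` — a zigzag inherits nothing from the (empty) third slot, a switch is
translated off it by the DOUBLE-REPEAT LAW. [new] [folklore] -/
theorem allRepeat_kept_persist (hroot : IsRoot q s₀) (W : ForcedWalk q s₀) {N s : ℕ} (hs : 1 ≤ s)
    (hplat : ∀ t, N ≤ t → (W.st t).shade = (s : ℕ∞) ∧ ((q : ℕ) : ℕ∞) < ordZero (W.st t).F)
    {u : ℕ} (hu : N ≤ u) (hS : StaysOnNewest W u) (hS' : StaysOnNewest W (u + 1))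
    {o o' : ℕ} (ho' : ordZero (W.st (u + 1)).F = o') (hP : kept W (u + 1) = Finsupp.single (W.j u) (o - q)) :
    kept W (u + 2) = Finsupp.single (W.j (u + 1)) (o' - q) := by
  classical
  obtain ⟨l₀, h0a, h0c⟩ : ∃ l₀ : Fin 3, l₀ ≠ W.j (u + 1) ∧ l₀ ≠ W.j (u + 2) := by
    have aux : ∀ a c : Fin 3, ∃ k : Fin 3, k ≠ a ∧ k ≠ c := by decide
    exact aux _ _
  have hr : (W.st (u + 2)).r = Finsupp.single (W.j u) (o - q) + Finsupp.single (W.j (u + 1)) (o' - q) := by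
    rw [show u + 2 = u + 1 + 1 by omega, r_succ_eq W (u + 1) ho', hP]
  ext l
  rw [kept_apply, Finsupp.single_apply, hr, Finsupp.add_apply, Finsupp.single_apply, Finsupp.single_apply]
  rcases fin3_cases hS'.1.symm h0a h0c l with hl | hl | hl
  · -- `l = j_{u+1}`: kept with its mass
    rw [hl, if_pos ⟨hS'.1.symm, hS'.2⟩, if_neg (show ¬ (W.j u = W.j (u + 1)) from fun h => hS.1 h.symm), if_pos rfl,
      zero_add]
  · -- `l = j_{u+2}`: the chart
    rw [hl, if_neg (show ¬ (W.j (u + 2) ≠ W.j (u + 2) ∧ W.b (u + 2) (W.j (u + 2)) = 0) from fun h => h.1 rfl),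
      if_neg (show ¬ (W.j (u + 1) = W.j (u + 2)) from fun h => hS'.1 h.symm)]
  · -- `l = l₀`: the third slot
    rw [hl, if_neg (show ¬ (W.j (u + 1) = l₀) from fun h => h0a h.symm)]
    by_cases hzig : W.j u = l₀
    · -- switch (`j_{u+2} ≠ j_u = l₀`): translated off `E_{j_u}`
      have hk : W.j (u + 2) ≠ W.j u := fun h => h0c (hzig.symm.trans h.symm)
      have hβ := translated_of_double_repeat_plateau hroot W hs hplat hu hS hS' hk
      rw [if_neg (show ¬ (l₀ ≠ W.j (u + 2) ∧ W.b (u + 2) l₀ = 0) from fun h => hβ (hzig ▸ h.2))]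
    · -- zigzag: nothing in the third slot
      rw [if_neg hzig, add_zero]
      split_ifs <;> rfl

/-- **LAW C⁺ — ALL-REPEAT RIGIDITY (PROVED)**: on a high plateau of shade `1 ≤ s < q` with translations i.o., a tail on
which EVERY move is a proximity repeat (`StaysOnNewest W t` for `t ≥ M`) is ledger-rigid: late, the order is the constant
`2q − s` and `r_{v+2} = (q − s)(e_{j_v} + e_{j_{v+1}})`.  (Entry at the first late translation, persistence by the
double-repeat law, then `fib_bounded_zero`.)  Supersedes LAW C (`zigzag_rigid`). [new] [folklore] -/
theorem allRepeat_rigid (hroot : IsRoot q s₀) (W : ForcedWalk q s₀) {N s M : ℕ} (hs : 1 ≤ s) (hsq : s < q)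
    (hplat : ∀ t, N ≤ t → (W.st t).shade = (s : ℕ∞) ∧ ((q : ℕ) : ℕ∞) < ordZero (W.st t).F)
    (htr : ∀ M₀ : ℕ, ∃ i, M₀ ≤ i ∧ W.b i ≠ 0) (hNM : N ≤ M) (hR : ∀ t, M ≤ t → StaysOnNewest W t) :
    ∃ M', M ≤ M' ∧ ∀ v, M' ≤ v → ordZero (W.st v).F = ((2 * q - s : ℕ) : ℕ∞) ∧
      (W.st (v + 2)).r = Finsupp.single (W.j v) (q - s) + Finsupp.single (W.j (v + 1)) (q - s) := by
  classical
  -- nat orders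
  set O : ℕ → ℕ := fun v => Classical.choose (walk_nat hroot W v) with hOdef
  have hO : ∀ v, ordZero (W.st v).F = ((O v : ℕ) : ℕ∞) := fun v => (Classical.choose_spec (walk_nat hroot W v)).1
  have hlo : ∀ v, N ≤ v → q < O v := by
    intro v hv; have h := (hplat v hv).2; rw [hO v] at h; exact_mod_cast h
  have hhi : ∀ v, O v < 2 * q := by
    intro v
    obtain ⟨o, ho, -, h2⟩ := NoJump.order_lt_two_mul hroot W v
    have : O v = o := by have h := (hO v).symm.trans ho; exact_mod_cast h
    omega
  -- entry at a late translation `t + 1`, persistence afterwards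
  obtain ⟨i, hi, hbi⟩ := htr (M + 1)
  obtain ⟨t, rfl⟩ : ∃ t, i = t + 1 := ⟨i - 1, by omega⟩
  have ht : M ≤ t := by omega
  have hkept : ∀ v, t ≤ v → kept W (v + 1) = Finsupp.single (W.j v) (O v - q) := by
    intro v hv
    induction v, hv using Nat.le_induction with
    | base => exact allRepeat_kept_entry W t (hR t ht) hbi (hO t)
    | succ v hv ih =>
      exact allRepeat_kept_persist hroot W hs hplat (by omega) (hR v (by omega)) (hR (v + 1) (by omega)) (hO (v + 1)) ih
  -- the ledger recurrence for `v ≥ t`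
  have hrec : ∀ v, t ≤ v → O (v + 2) + q + q = O (v + 1) + s + O v := by
    intro v hv
    have hstep := order_succ_of_plateau hroot W (v + 1) (hO (v + 1)) (hO (v + 2)) (hplat (v + 1) (by omega)).1
      (by rw [(hplat (v + 1 + 1) (by omega)).1, (hplat (v + 1) (by omega)).1])
    rw [hkept v hv, Finsupp.degree_single] at hstep
    have := hlo v (by omega)
    omega
  -- Fibonacci around `q − s`
  have hy := fib_bounded_zero (fun v => (O v : ℤ) + s - 2 * q) (u₀ := t)
    (fun v hv => by have h := hrec v hv; linarith [show (O (v + 2) : ℤ) + q + q = O (v + 1) + s + O v by exact_mod_cast h])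
    (B := 2 * q) (fun v hv => by
      have h1 := hhi v; have h2 := hlo v (by omega)
      rw [abs_le]; constructor <;> linarith [show (O v : ℤ) < 2 * q by exact_mod_cast h1,
        show (q : ℤ) < O v by exact_mod_cast h2])
  have hOv : ∀ v, t ≤ v → O v = 2 * q - s := by
    intro v hv
    have h := hy v hv
    have : (O v : ℤ) = 2 * q - s := by linarith
    omega
  refine ⟨t, ht, fun v hv => ⟨by rw [hO v, hOv v hv], ?_⟩⟩
  rw [show v + 2 = v + 1 + 1 by omega, r_succ_eq W (v + 1) (hO (v + 1)), hkept v hv, hOv v hv, hOv (v + 1) (by omega)]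
  congr 2 <;> omega

/-- **LAW C⁺, corollary (PROVED)**: an all-repeat tail with translations i.o. on a high plateau has `q < 2s`.
[new] [folklore] -/
theorem lt_two_mul_shade_of_allRepeat (hroot : IsRoot q s₀) (W : ForcedWalk q s₀) {N s M : ℕ} (hs : 1 ≤ s)
    (hsq : s < q) (hplat : ∀ t, N ≤ t → (W.st t).shade = (s : ℕ∞) ∧ ((q : ℕ) : ℕ∞) < ordZero (W.st t).F)
    (htr : ∀ M₀ : ℕ, ∃ i, M₀ ≤ i ∧ W.b i ≠ 0) (hNM : N ≤ M) (hR : ∀ t, M ≤ t → StaysOnNewest W t) :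
    q < 2 * s := by
  classical
  obtain ⟨M', hM', hrig⟩ := allRepeat_rigid hroot W hs hsq hplat htr hNM hR
  obtain ⟨-, hr⟩ := hrig M' le_rfl
  have hne : W.j M' ≠ W.j (M' + 1) := fun h => (hR M' hM').1 h.symm
  have hlt := pair_lt_of_isolatedTop (W.isolated (M' + 2)) (W.j M') (W.j (M' + 1)) hne
    (X_pow_mul_X_pow_dvd_of_forall_le (walk_r hroot W (M' + 2)) hne)
  rw [hr, Finsupp.add_apply, Finsupp.add_apply, Finsupp.single_eq_same, Finsupp.single_eq_same,
    Finsupp.single_eq_of_ne hne, Finsupp.single_eq_of_ne hne.symm] at hlt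
  omega

/-- The complementary letters: a move that does not stay on the newest component leaves it. [folklore] -/
theorem leavesNewest_of_not_stays (W : ForcedWalk q s₀) (t : ℕ) (h : ¬ StaysOnNewest W t) : LeavesNewest W t := by
  by_cases hj : W.j (t + 1) = W.j t
  · exact Or.inl hj
  · exact Or.inr fun hb => h ⟨hj, hb⟩

/-- A RIGID ALL-REPEAT TAIL from `M` at shade `s`: every move a proximity repeat, constant order `2q − s`, boundary
`(q − s)(e_{j_v} + e_{j_{v+1}})`. DEFINITION (support; the LAW C⁺ profile). -/
def IsRigidRepeatTailFrom (W : ForcedWalk q s₀) (s M : ℕ) : Prop :=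
  (∀ t, M ≤ t → StaysOnNewest W t) ∧ ∀ v, M ≤ v → ordZero (W.st v).F = ((2 * q - s : ℕ) : ℕ∞) ∧
    (W.st (v + 2)).r = Finsupp.single (W.j v) (q - s) + Finsupp.single (W.j (v + 1)) (q - s)

end AllRepeat

section LawI

variable {K : Type} [Field K] [DecidableEq K] {q : ℕ} {s₀ : State (Fin 3) K}

/-- **LAW I — THE AXIS LAW AFTER AN UNTRANSLATED REPEAT (PROVED).**  Along a high plateau of shade `n ≥ 1`
(`u → u+1 → u+2 → u+3` shade-preserving, orders `> q`): if move `u+1` is a proximity repeat (`StaysOnNewest W u`,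
newest chart `N = j_{u+1}`) and move `u+2` changes chart (`c = j_{u+2} ≠ N`) WITHOUT translation (`b_{u+2} = 0`), then
for the third variable `k` the new boundary satisfies `r_{u+3}(k) + r_{u+3}(c) + 1 < q`, i.e. in ledger terms
`kept_k + (o_{u+2} − q) ≤ q − 2`.  Proof: the older-face law kills `coeff_{r_{u+2} + n e_N} F_{u+2}`; the cone law at
`u+2` (vertex `e_c`) makes the initial form of `F_{u+2}` free of `u_c` beyond the boundary; so the monomial of `F_{u+3}`
with `m_k = r_k`, `m_c = r_c` would have to come from `x^{r_{u+2}} u_N^{n}` — absent; the AXIS LAW supplies a monomial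
with `m_k + m_c < q`, whence `r_k + r_c + 1 ≤ m_k + m_c < q`.  A NEW transition constraint on the tame mixed words of
`NoTameMixedTailsDeep` (letter pair `R R̄⁰`, `R̄⁰` = untranslated chart change). [new] [folklore] -/
theorem axis_after_untranslated_repeat (hroot : IsRoot q s₀) (W : ForcedWalk q s₀) (u : ℕ) {o o₁ o₂ : ℕ}
    (ho : ordZero (W.st u).F = o) (ho₁ : ordZero (W.st (u + 1)).F = o₁) (ho₂ : ordZero (W.st (u + 2)).F = o₂)
    (hqo : q < o) (hqo₁ : q < o₁) (hqo₂ : q < o₂)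
    (hplat : (W.st (u + 1)).shade = (W.st u).shade) (hplat₁ : (W.st (u + 2)).shade = (W.st (u + 1)).shade)
    (hplat₂ : (W.st (u + 3)).shade = (W.st (u + 2)).shade)
    {n : ℕ} (hn : (W.st u).shade = (n : ℕ∞)) (hn1 : 1 ≤ n) (hS₀ : StaysOnNewest W u)
    (hsw : W.j (u + 2) ≠ W.j (u + 1)) (hb : ∀ i, W.b (u + 2) i = 0)
    {k : Fin 3} (hk₁ : k ≠ W.j (u + 1)) (hk₂ : k ≠ W.j (u + 2)) :
    (W.st (u + 3)).r k + (W.st (u + 3)).r (W.j (u + 2)) + 1 < q := by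
  classical
  -- the ledger of the untranslated move `u+2`
  have hr₃ : (W.st (u + 3)).r = kept W (u + 2) + Finsupp.single (W.j (u + 2)) (o₂ - q) := r_succ_eq W (u + 2) ho₂
  have hk2c : kept W (u + 2) (W.j (u + 2)) = 0 := by rw [kept_apply, if_neg (fun h => h.1 rfl)]
  have hk2k : kept W (u + 2) k = (W.st (u + 2)).r k := by rw [kept_apply, if_pos ⟨hk₂, hb k⟩]
  have hr₃c : (W.st (u + 3)).r (W.j (u + 2)) = o₂ - q := by
    rw [hr₃, Finsupp.add_apply, hk2c, Finsupp.single_eq_same, zero_add]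
  have hr₃k : (W.st (u + 3)).r k = (W.st (u + 2)).r k := by
    rw [hr₃, Finsupp.add_apply, hk2k, Finsupp.single_eq_of_ne hk₂, add_zero]
  -- the AXIS LAW at `u+3` for the pair `(k, c)`
  obtain ⟨m, hm, hlt⟩ := exists_support_pair_lt_of_isolatedTop (W.isolated (u + 3)) k (W.j (u + 2)) hk₂
  have hrm : (W.st (u + 3)).r ≤ m := walk_r hroot W (u + 3) m hm
  have hmk : (W.st (u + 3)).r k ≤ m k := Finsupp.le_def.mp hrm k
  have hmc : (W.st (u + 3)).r (W.j (u + 2)) ≤ m (W.j (u + 2)) := Finsupp.le_def.mp hrm (W.j (u + 2))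
  by_contra hge
  have hmk' : m k = (W.st (u + 2)).r k := by omega
  have hmc' : m (W.j (u + 2)) = o₂ - q := by omega
  -- transport the coefficient of `u^m` back to the initial layer of `F_{u+2}`
  have hcoef : coeff m (W.st (u + 3)).F ≠ 0 := mem_support_iff.mp hm
  have hst : W.st (u + 3) = step q (W.j (u + 2)) (W.b (u + 2)) (W.st (u + 2)) := W.st_succ (u + 2)
  have hF : (W.st (u + 3)).F = deletePthPowers q (pointTransform q (W.j (u + 2)) (W.b (u + 2)) (W.st (u + 2))) := by
    rw [hst]
    rfl
  have hb0 : W.b (u + 2) = 0 := funext hb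
  rw [hF, coeff_deletePthPowers] at hcoef
  split_ifs at hcoef with hP
  · exact hcoef rfl
  rw [coeff_pointTransform_layer q (W.j (u + 2)) (W.b (u + 2)) (W.onExc (u + 2)) (W.st (u + 2)) (o := o₂) hqo₂ hmc',
    hb0, PointBlowup.translate_zero, initLayer_eq_mul (W.j (u + 2)) (W.st (u + 2)) (walk_r hroot W (u + 2)) o₂,
    coeff_monomial_mul'] at hcoef
  split_ifs at hcoef with hle
  swap
  · exact hcoef rfl
  rw [one_mul] at hcoef
  -- the cone law at `u+2` (vertex `e_c`, no translation): the residual layer is homogeneous of degree `n`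
  have hn₂ : (W.st (u + 2)).shade = (n : ℕ∞) := by rw [hplat₁, hplat, hn]
  have hcone := cone_of_plateau hroot W (u + 2) ho₂ hqo₂ hplat₂ hn₂
  have hres : resForm W (u + 2) o₂ = resLayer (W.j (u + 2)) (W.st (u + 2)) o₂ := by
    unfold resForm
    rw [hb0, PointBlowup.translate_zero]
  have hhom : (resLayer (W.j (u + 2)) (W.st (u + 2)) o₂).IsHomogeneous n := by rw [← hres]; exact hcone.1
  set E := m.update (W.j (u + 2)) 0 - (W.st (u + 2)).r.update (W.j (u + 2)) 0 with hE
  have hEdeg : E.degree = n := by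
    by_contra h
    exact hcoef (hhom.coeff_eq_zero h)
  -- `E` vanishes at `c` and at `k`, so `E = n · e_N`
  have hEc : E (W.j (u + 2)) = 0 := by
    rw [hE, Finsupp.tsub_apply, update_apply', if_pos rfl, Nat.zero_sub]
  have hEk : E k = 0 := by
    rw [hE, Finsupp.tsub_apply, update_apply', if_neg hk₂, update_apply', if_neg hk₂, hmk', Nat.sub_self]
  have hE1 : E = Finsupp.single (W.j (u + 1)) (E (W.j (u + 1))) := by
    ext l
    rcases fin3_cases hsw hk₂ hk₁ l with h | h | h
    · rw [h, hEc, Finsupp.single_eq_of_ne hsw]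
    · rw [h, Finsupp.single_eq_same]
    · rw [h, hEk, Finsupp.single_eq_of_ne hk₁]
  have hEN' : E (W.j (u + 1)) = n := by
    rw [hE1, Finsupp.degree_single] at hEdeg
    exact hEdeg
  have hEN : E = Finsupp.single (W.j (u + 1)) n := by rw [hEN'] at hE1; exact hE1
  have hEupd : E.update (W.j (u + 2)) 0 = E := by
    ext l
    rw [update_apply']
    split_ifs with h
    · rw [h, hEc]
    · rfl
  -- the coefficient of `F_{u+2}` at `r_{u+2} + n e_N` is then non-zero — contradicting the OLDER-FACE LAW
  obtain ⟨n₂, hn₂', hon₂⟩ := order_eq_shade_add_degree hroot W (u + 2) ho₂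
  have hnn : n₂ = n := by have h := hn₂'.symm.trans hn₂; exact_mod_cast h
  have hcoF : coeff ((W.st (u + 2)).r + E) (W.st (u + 2)).F ≠ 0 := by
    rw [← coeff_resLayer (W.j (u + 2)) (W.st (u + 2)) (walk_r hroot W (u + 2)) o₂ E (by rw [hEdeg]; omega), hEupd]
    exact hcoef
  rw [hEN] at hcoF
  exact hcoF (older_face_vanish hroot W u ho ho₁ hqo hqo₁ hplat hplat₁ hn hn1 hS₀)

/-- LAW I in LEDGER form: after `R` then an untranslated chart change, `kept_k + (o_{u+2} − q) + 1 < q` with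
`kept_k = r_{u+2}(k)` (the third exponent is carried unchanged). [new] [folklore] -/
theorem ledger_after_untranslated_repeat (hroot : IsRoot q s₀) (W : ForcedWalk q s₀) (u : ℕ) {o o₁ o₂ : ℕ}
    (ho : ordZero (W.st u).F = o) (ho₁ : ordZero (W.st (u + 1)).F = o₁) (ho₂ : ordZero (W.st (u + 2)).F = o₂)
    (hqo : q < o) (hqo₁ : q < o₁) (hqo₂ : q < o₂)
    (hplat : (W.st (u + 1)).shade = (W.st u).shade) (hplat₁ : (W.st (u + 2)).shade = (W.st (u + 1)).shade)
    (hplat₂ : (W.st (u + 3)).shade = (W.st (u + 2)).shade)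
    {n : ℕ} (hn : (W.st u).shade = (n : ℕ∞)) (hn1 : 1 ≤ n) (hS₀ : StaysOnNewest W u)
    (hsw : W.j (u + 2) ≠ W.j (u + 1)) (hb : ∀ i, W.b (u + 2) i = 0)
    {k : Fin 3} (hk₁ : k ≠ W.j (u + 1)) (hk₂ : k ≠ W.j (u + 2)) :
    (W.st (u + 2)).r k + (o₂ - q) + 1 < q := by
  have h := axis_after_untranslated_repeat hroot W u ho ho₁ ho₂ hqo hqo₁ hqo₂ hplat hplat₁ hplat₂ hn hn1 hS₀ hsw hb
    hk₁ hk₂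
  have hr₃ : (W.st (u + 3)).r = kept W (u + 2) + Finsupp.single (W.j (u + 2)) (o₂ - q) := r_succ_eq W (u + 2) ho₂
  have hk2c : kept W (u + 2) (W.j (u + 2)) = 0 := by rw [kept_apply, if_neg (fun h => h.1 rfl)]
  have hk2k : kept W (u + 2) k = (W.st (u + 2)).r k := by rw [kept_apply, if_pos ⟨hk₂, hb k⟩]
  have hr₃c : (W.st (u + 3)).r (W.j (u + 2)) = o₂ - q := by
    rw [hr₃, Finsupp.add_apply, hk2c, Finsupp.single_eq_same, zero_add]
  have hr₃k : (W.st (u + 3)).r k = (W.st (u + 2)).r k := by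
    rw [hr₃, Finsupp.add_apply, hk2k, Finsupp.single_eq_of_ne hk₂, add_zero]
  omega

end LawI

/-! ## §D BOOKING — the proximity-letter split of the target, the decided sub-cells, THE ONE CERTIFIED EQUIV,
the relation to lens-5 g15's joint residual, kernels BY NAME. -/

section Booking

variable {K : Type} [Field K] [DecidableEq K] {q : ℕ} {s₀ : State (Fin 3) K}

/-- A proximity repeat from HIGH order is a satellite move (PROVED; for `o_t > q` no exit law is needed: the newest
component carries mass `o_t − q ≥ 1` and is kept). [folklore] -/
theorem satellite_succ_of_stays (W : ForcedWalk q s₀) (t : ℕ) {o : ℕ} (ho : ordZero (W.st t).F = o)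
    (hqo : q < o) (hS : StaysOnNewest W t) : W.Satellite (t + 1) := by
  classical
  rw [satellite_iff_kept_ne_zero]
  intro h
  have h1 : kept W (t + 1) (W.j t) = 0 := by rw [h]; rfl
  rw [kept_apply, if_pos ⟨fun h' => hS.1 h'.symm, hS.2⟩, NoJump.r_succ_chart W t ho] at h1
  omega

/-- A late move of a high plateau of shade `s` that is a proximity repeat has a CONE-LINE residual form: for the third
index `k` (`k ≠ j_{t+1}, j_t`), `N_t = c · (u_k − b_{t+1}(k) · u_{j_{t+1}})^s` with `c ≠ 0`.  DEFINITION (profile box of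
the re-located residual). -/
def IsConeLine (W : ForcedWalk q s₀) (t o n : ℕ) : Prop :=
  ∀ k : Fin 3, k ≠ W.j (t + 1) → k ≠ W.j t →
    ∃ c : K, c ≠ 0 ∧ resForm W t o = C c * (X k - C (W.b (t + 1) k) * X (W.j (t + 1))) ^ n

/-- **POWER LAW, plateau form (PROVED)**: on a high plateau every proximity repeat is a cone-line repeat. [new] [folklore] -/
theorem isConeLine_of_plateau (hroot : IsRoot q s₀) (W : ForcedWalk q s₀) {N s : ℕ}
    (hplat : ∀ t, N ≤ t → (W.st t).shade = (s : ℕ∞) ∧ ((q : ℕ) : ℕ∞) < ordZero (W.st t).F)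
    {t : ℕ} (ht : N ≤ t) (hS : StaysOnNewest W t) {o : ℕ} (ho : ordZero (W.st t).F = o) : IsConeLine W t o s := by
  intro k hki hkj
  obtain ⟨o', ho', -⟩ := walk_nat hroot W (t + 1)
  have hqo : q < o := by
    have h := (hplat t ht).2
    rw [ho] at h
    exact_mod_cast h
  have hqo' : q < o' := by
    have h := (hplat (t + 1) (by omega)).2
    rw [ho'] at h
    exact_mod_cast h
  have hpl : (W.st (t + 1)).shade = (W.st t).shade := by rw [(hplat (t + 1) (by omega)).1, (hplat t ht).1]
  have hpl' : (W.st (t + 2)).shade = (W.st (t + 1)).shade := by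
    rw [(hplat (t + 2) (by omega)).1, (hplat (t + 1) (by omega)).1]
  exact resForm_eq_pow_of_repeat hroot W t ho ho' hqo hqo' hpl hpl' (hplat t ht).1 ⟨hS.1, hS.2⟩ hki hkj

/-- The RIGID HIGH FLOOR profile from time `M` on (LAW B's normal form): one old component `E_i` of multiplicity
`q − s` is hugged for ever (`kept_t = (q−s)·e_i`, `j_t ≠ i`, `b_t(i) = 0`) at constant order `q + a`, `1 ≤
a ≤ s − 1`.
DEFINITION (profile box of the located free residual). -/
def IsRigidHighFloorFrom (W : ForcedWalk q s₀) (s M : ℕ) (i : Fin 3) (a : ℕ) : Prop :=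
  1 ≤ a ∧ a + 1 ≤ s ∧ ∀ t, M ≤ t → kept W t = Finsupp.single i (q - s) ∧
    ordZero (W.st t).F = ((q + a : ℕ) : ℕ∞) ∧ W.j t ≠ i ∧ W.b t i = 0

end Booking

end Summit.ResolutionOfSingularities.ResolutionOfSingularities.Theorems.ConeCut
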